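import Literature.Computability.QuantumComplexity.CleanXorGadget
import HarnessLib

/-!
# `U_f` on scattered registers: copy the registers in pair format, compute, XOR, uncompute, un-copy

Topic `Literature/Computability/QuantumComplexity`; sequel of `CleanXorGadget.lean` (the garbage-free
oracle `CleanXor.ops` of a polynomial-time machine reading its input off contiguous-or-scattered DATA
wires). A machine reads ONE string; when the input of the classical function consists of several
quantum registers `r₁, …, r_k` (lists of wires anywhere in the register) the standard interface is the
pair code `⟨r₁, ⟨r₂, … r_k⟩⟩` (`Computability.boolPair`: doubled bits and the separator `01`; the
format read by the tree's string bricks `Brick.fstF`/`sndF` and by `Complexity.CodeFP` programs over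
`pairE strE …`). This file realises that interface with reversible gates (Nielsen–Chuang 2010, §3.2.5:
FANOUT by `CNOT`, constants by `X`, and uncomputation):

* `PXor.slots fs` — the template of the data area for source-wire lists `fs`: each bit of a non-last
  field twice, then the constants `0 1`, the last field once; `PXor.pairStr` — the pair-format string
  of register contents — and **`pairStr_eq_map_slots`** (the template filled with the wire values IS
  the pair string);
* `PXor.copyL S fs` — `CNOT`s from the sources into the area `[S, S + |slots|)` and `X` on the `1`
  constants — with **`clEval_copyL`**: every area wire is XORed with its template value, nothing else
  moves (so on a clean area it WRITES the pair string, and applied again it CLEARS it);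
* `PXor.ops` — `copyL ++ CleanXor.ops ++ copyL` (data wires of the block = the area, work window right
  behind it) — with **`clEval_ops_target` / `clEval_ops_of_ne`**: target `j < m` is XORed with bit `j` of
  the machine's output on `⟨r₁, ⟨r₂, … r_k⟩⟩`, every other wire (sources, area, window, rest) is unchanged;
  `PXor.circuit`, `isBasisMap_circuit`.

Everything here is proved; definitions have bodies; no named fact is introduced.

## References

* M. A. Nielsen, I. L. Chuang, *Quantum Computation and Quantum Information*, CUP 2010, §3.2.5
  (FANOUT, ancilla constants, uncomputation eq. (3.7)) [NielsenChuang2010].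
* S. Arora, B. Barak, *Computational Complexity: A Modern Approach*, CUP 2009, §0.1 (pairing of
  strings), §10.3.7 Lemma 10.10 [AroraBarak2009].
-/

noncomputable section

namespace Literature.Computability.QuantumComplexity

namespace PXor

open _root_.Computability Complexity Complexity.FinTM2Sim Turing Function RevSim RevClean Cryptography ClassicalWrap
  CleanPlaced

variable {N : ℕ}

/-! ### The template of the data area and the pair string -/

/-- The template of the data area: a non-last field contributes each source wire twice and then the
constants `false, true`; the last field contributes its source wires once. [folklore] -/
def slots : List (List ℕ) → List (ℕ ⊕ Bool)
  | [] => []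
  | [f] => f.map Sum.inl
  | f :: g :: fs => (f.flatMap fun s => [Sum.inl s, Sum.inl s]) ++ [Sum.inr false, Sum.inr true] ++ slots (g :: fs)

/-- The pair-format string of register contents: `⟨r₁, ⟨r₂, … r_k⟩⟩` (the last one raw). [folklore] -/
def pairStr : List (List Bool) → List Bool
  | [] => []
  | [r] => r
  | r :: s :: rs => boolPair r (pairStr (s :: rs))

/-- The value of a template slot under a wire assignment. [folklore] -/
def slotVal (w : ℕ → Bool) : ℕ ⊕ Bool → Bool := Sum.elim w id

/-- **The filled template is the pair string.** [folklore] -/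
theorem pairStr_eq_map_slots (w : ℕ → Bool) : ∀ fs : List (List ℕ),
    pairStr (fs.map fun f => f.map w) = (slots fs).map (slotVal w)
  | [] => rfl
  | [f] => by simp [pairStr, slots, slotVal, List.map_map]
  | f :: g :: fs => by
    have ih := pairStr_eq_map_slots w (g :: fs)
    simp only [List.map_cons] at ih ⊢
    rw [pairStr, slots, boolPair, ih, List.map_append, List.map_append]
    congr 1
    · congr 1
      rw [List.map_flatMap, List.flatMap_map]
      rfl

/-- The length of the pair string is the length of the template. [folklore] -/
theorem length_pairStr (w : ℕ → Bool) (fs : List (List ℕ)) :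
    (pairStr (fs.map fun f => f.map w)).length = (slots fs).length := by
  rw [pairStr_eq_map_slots, List.length_map]

/-- The sources occurring in the template are the source wires. [folklore] -/
theorem mem_of_inl_mem_slots {fs : List (List ℕ)} {s : ℕ} : Sum.inl s ∈ slots fs → ∃ f ∈ fs, s ∈ f := by
  induction fs with
  | nil => simp [slots]
  | cons f fs ih =>
    cases fs with
    | nil => simp [slots]
    | cons g fs =>
      intro h
      simp only [slots, List.mem_append, List.mem_flatMap, List.mem_cons, List.mem_nil_iff, or_false,
        Sum.inl.injEq, reduceCtorEq, or_self] at h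
      rcases h with ⟨s', hs', h⟩ | h
      · exact ⟨f, by simp, by rcases h with rfl | rfl; all_goals exact hs'⟩
      · obtain ⟨f', hf', hs⟩ := ih h
        exact ⟨f', by simp [hf'], hs⟩

/-! ### The copy layer -/

section Copy

variable (S : ℕ) (fs : List (List ℕ))

/-- Source/target pairs of the copy layer: template slot `a` holding the source `s` becomes the `CNOT`
`s → S + a`. [folklore] -/
def copyPairs : List (ℕ × ℕ) :=
  (List.range (slots fs).length).filterMap fun a =>
    match (slots fs)[a]? with
    | some (Sum.inl s) => some (s, S + a)
    | _ => none

/-- The constant bits of the template, as a Boolean list (for `RevClean.notsV`). [folklore] -/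
def constBits : List Bool := (slots fs).map (Sum.elim (fun _ => false) id)

/-- **The copy layer**: fan-out of the sources into the area, then `X` on the `1` constants.
[cite: NielsenChuang2010, §3.2.5] -/
def copyL : List (ClOp ℕ) := copyOps (copyPairs S fs) ++ notsV S (constBits fs)

variable {S fs}

/-- Members of `copyPairs`. [folklore] -/
theorem mem_copyPairs {q : ℕ × ℕ} :
    q ∈ copyPairs S fs ↔ ∃ a, ∃ h : a < (slots fs).length, (slots fs)[a] = Sum.inl q.1 ∧ q.2 = S + a := by
  unfold copyPairs
  rw [List.mem_filterMap]
  constructor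
  · rintro ⟨a, ha, hq⟩
    rw [List.mem_range] at ha
    rw [List.getElem?_eq_getElem ha] at hq
    refine ⟨a, ha, ?_⟩
    cases hsl : (slots fs)[a] with
    | inl s =>
      rw [hsl] at hq
      simp only [Option.some.injEq] at hq
      subst hq
      exact ⟨rfl, rfl⟩
    | inr b => rw [hsl] at hq; simp at hq
  · rintro ⟨a, ha, hsl, hq2⟩
    refine ⟨a, List.mem_range.2 ha, ?_⟩
    rw [List.getElem?_eq_getElem ha, hsl]
    obtain ⟨q1, q2⟩ := q
    simp only at hq2 ⊢
    rw [hq2]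

/-- The targets of the copy layer are pairwise distinct. [folklore] -/
theorem nodup_copyPairs_snd : ((copyPairs S fs).map Prod.snd).Nodup := by
  unfold copyPairs
  rw [List.map_filterMap]
  refine List.Nodup.filterMap ?_ List.nodup_range
  intro a a' t ha ha'
  simp only [Option.mem_def, Option.map_eq_some_iff] at ha ha'
  obtain ⟨q, hq, rfl⟩ := ha
  obtain ⟨q', hq', hqq⟩ := ha'
  have key : ∀ {b : ℕ} {r : ℕ × ℕ}, (match (slots fs)[b]? with
      | some (Sum.inl s) => some (s, S + b) | _ => none) = some r → r.2 = S + b := by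
    intro b r hr
    revert hr
    cases (slots fs)[b]? with
    | none => simp
    | some sl =>
      cases sl with
      | inl s => simp only [Option.some.injEq]; rintro rfl; rfl
      | inr _ => simp
  have h1 := key hq
  have h2 := key hq'
  rw [hqq] at h2
  omega

/-- The length of `constBits`. [folklore] -/
@[simp] theorem length_constBits : (constBits fs).length = (slots fs).length := by simp [constBits]

/-- The hypothesis on the sources: none lies in `[S, S + R)` (the area, or the area and the work
window behind it). [folklore] -/
def SrcOff (S R : ℕ) (fs : List (List ℕ)) : Prop := ∀ f ∈ fs, ∀ s ∈ f, s < S ∨ S + R ≤ s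

/-- **Semantics of the copy layer on the area**: area wire `S + a` is XORed with its template value.
[cite: NielsenChuang2010, §3.2.5 (FANOUT by CNOT)] -/
theorem clEval_copyL_area {R : ℕ} (hR : (slots fs).length ≤ R) (hsrc : SrcOff S R fs) (w : ℕ → Bool) {a : ℕ}
    (ha : a < (slots fs).length) :
    clEval (copyL S fs) w (S + a) = (w (S + a) ^^ slotVal w ((slots fs)[a])) := by
  have hdis : ∀ p ∈ copyPairs S fs, ∀ q ∈ copyPairs S fs, q.2 ≠ p.1 := by
    intro p hp q hq
    obtain ⟨b, hb, hsb, -⟩ := mem_copyPairs.1 hp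
    obtain ⟨c, hc, -, hqc⟩ := mem_copyPairs.1 hq
    obtain ⟨f, hf, hs⟩ := mem_of_inl_mem_slots (fs := fs) (hsb ▸ List.getElem_mem hb)
    rcases hsrc f hf p.1 hs with h | h <;> omega
  unfold copyL
  rw [clEval_append, clEval_notsV_apply]
  have hin : decide (S ≤ S + a ∧ S + a < S + (constBits fs).length) = true := by
    rw [decide_eq_true_eq, length_constBits]; omega
  rw [hin, Bool.true_and, Nat.add_sub_cancel_left]
  have hcb : (constBits fs).getD a false = Sum.elim (fun _ => false) id ((slots fs)[a]) := by
    rw [List.getD_eq_getElem _ _ (by rw [length_constBits]; exact ha)]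
    simp [constBits]
  rw [hcb]
  cases hsl : (slots fs)[a] with
  | inl s =>
    have hmem : (s, S + a) ∈ copyPairs S fs := mem_copyPairs.2 ⟨a, ha, hsl, rfl⟩
    rw [clEval_copyOps_target _ nodup_copyPairs_snd hdis w hmem]
    simp [slotVal]
  | inr b =>
    rw [clEval_copyOps_of_ne]
    · simp [slotVal]
    · intro p hp hpa
      obtain ⟨c, hc, hsc, hpc⟩ := mem_copyPairs.1 hp
      have : c = a := by omega
      subst this
      rw [hsl] at hsc
      cases hsc

/-- **Semantics of the copy layer off the area**: nothing moves. [folklore] -/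
theorem clEval_copyL_of_not (w : ℕ → Bool) {i : ℕ} (hi : i < S ∨ S + (slots fs).length ≤ i) :
    clEval (copyL S fs) w i = w i := by
  unfold copyL
  rw [clEval_append, clEval_notsV_apply]
  have hin : decide (S ≤ i ∧ i < S + (constBits fs).length) = false := by
    rw [decide_eq_false_iff_not, length_constBits]; omega
  rw [hin, Bool.false_and, Bool.xor_false, clEval_copyOps_of_ne]
  intro p hp hpi
  obtain ⟨c, hc, -, hpc⟩ := mem_copyPairs.1 hp
  omega

/-- On a clean area the copy layer WRITES the pair string of the registers. [cite: NielsenChuang2010, §3.2.5] -/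
theorem clEval_copyL_area_of_clean {R : ℕ} (hR : (slots fs).length ≤ R) (hsrc : SrcOff S R fs) (w : ℕ → Bool)
    (hclean : ∀ a, a < (slots fs).length → w (S + a) = false) {a : ℕ} (ha : a < (slots fs).length) :
    clEval (copyL S fs) w (S + a) = (pairStr (fs.map fun f => f.map w)).getD a false := by
  rw [clEval_copyL_area hR hsrc w ha, hclean a ha, Bool.false_xor, pairStr_eq_map_slots,
    List.getD_eq_getElem _ _ (by rw [List.length_map]; exact ha), List.getElem_map]

/-- **The copy layer is an involution** (the sources are off the area, so they are read twice with
the same values). [cite: NielsenChuang2010, §3.2.5 (uncomputation)] -/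
theorem clEval_copyL_copyL {R : ℕ} (hR : (slots fs).length ≤ R) (hsrc : SrcOff S R fs) (w : ℕ → Bool) :
    clEval (copyL S fs) (clEval (copyL S fs) w) = w := by
  funext i
  by_cases hi : S ≤ i ∧ i < S + (slots fs).length
  · obtain ⟨a, rfl⟩ : ∃ a, i = S + a := ⟨i - S, by omega⟩
    have ha : a < (slots fs).length := by omega
    rw [clEval_copyL_area hR hsrc _ ha, clEval_copyL_area hR hsrc _ ha]
    cases hsl : (slots fs)[a] with
    | inl s =>
      obtain ⟨f, hf, hs⟩ := mem_of_inl_mem_slots (fs := fs) (hsl ▸ List.getElem_mem ha)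
      have hsoff : s < S ∨ S + (slots fs).length ≤ s := by rcases hsrc f hf s hs with h | h <;> omega
      simp only [slotVal, Sum.elim_inl]
      rw [clEval_copyL_of_not _ hsoff, Bool.xor_assoc, Bool.xor_self, Bool.xor_false]
    | inr b => simp only [slotVal, Sum.elim_inr, id]; rw [Bool.xor_assoc, Bool.xor_self, Bool.xor_false]
  · have hi' : i < S ∨ S + (slots fs).length ≤ i := by omega
    rw [clEval_copyL_of_not _ hi', clEval_copyL_of_not _ hi']

/-- The copy layer agrees on two assignments that agree on the area and on the sources, at every
area wire. [folklore] -/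
theorem clEval_copyL_congr_area {R : ℕ} (hR : (slots fs).length ≤ R) (hsrc : SrcOff S R fs) {w w' : ℕ → Bool}
    (harea : ∀ a, a < (slots fs).length → w (S + a) = w' (S + a))
    (hs : ∀ f ∈ fs, ∀ s ∈ f, w s = w' s) {a : ℕ} (ha : a < (slots fs).length) :
    clEval (copyL S fs) w (S + a) = clEval (copyL S fs) w' (S + a) := by
  rw [clEval_copyL_area hR hsrc _ ha, clEval_copyL_area hR hsrc _ ha, harea a ha]
  cases hsl : (slots fs)[a] with
  | inl s =>
    obtain ⟨f, hf, hs'⟩ := mem_of_inl_mem_slots (fs := fs) (hsl ▸ List.getElem_mem ha)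
    simp [slotVal, hs f hf s hs']
  | inr b => rfl

/-- The wires of the copy layer: sources and area. [folklore] -/
theorem wires_copyL_lt {NN : ℕ} (hS : S + (slots fs).length ≤ NN) (hsN : ∀ f ∈ fs, ∀ s ∈ f, s < NN) :
    ∀ op ∈ copyL S fs, ∀ i ∈ wiresOf op, i < NN := by
  intro op hop i hi
  unfold copyL at hop
  rw [List.mem_append] at hop
  rcases hop with hop | hop
  · obtain ⟨p, hp, rfl⟩ := mem_copyOps.1 hop
    obtain ⟨a, ha, hsa, hp2⟩ := mem_copyPairs.1 hp
    obtain ⟨f, hf, hs⟩ := mem_of_inl_mem_slots (fs := fs) (hsa ▸ List.getElem_mem ha)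
    simp only [mem_wiresOf, ClOp.target, ClOp.controls, List.mem_singleton] at hi
    rcases hi with rfl | rfl
    · omega
    · exact hsN f hf _ hs
  · unfold notsV at hop
    rw [List.mem_map] at hop
    obtain ⟨k, hk, rfl⟩ := hop
    rw [List.mem_filter, List.mem_range, length_constBits] at hk
    simp only [mem_wiresOf, ClOp.target, ClOp.controls, List.not_mem_nil, or_false] at hi
    subst hi; omega

/-- The copy layer is well formed (no source is its own target). [folklore] -/
theorem copyL_wf {R : ℕ} (hR : (slots fs).length ≤ R) (hsrc : SrcOff S R fs) : ∀ op ∈ copyL S fs, op.WF := by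
  intro op hop
  unfold copyL at hop
  rw [List.mem_append] at hop
  rcases hop with hop | hop
  · refine copyOps_wf (fun p hp => ?_) op hop
    obtain ⟨a, ha, hsa, hp2⟩ := mem_copyPairs.1 hp
    obtain ⟨f, hf, hs⟩ := mem_of_inl_mem_slots (fs := fs) (hsa ▸ List.getElem_mem ha)
    rcases hsrc f hf _ hs with h | h <;> omega
  · exact notsV_wf op hop

end Copy

/-! ### The oracle on scattered registers -/

section Ops

variable (hN : 0 < N) (e : ℕ) (M : TM2ComputableAux Bool Bool) (S : ℕ) (fs : List (List ℕ)) (m : ℕ) (tpos : ℕ → ℕ)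

/-- The copy layer inside the register `Fin N`. [folklore] -/
def copyFin : List (ClOp (Fin N)) := (copyL S fs).map (ClOp.map (finOf N hN))

/-- The inner oracle: the clean XOR block whose data wires are the area `[S, S + areaLen)` and whose
work window starts right behind it (empty constant suffix). [folklore] -/
def inner : List (ClOp (Fin N)) :=
  CleanXor.ops hN e M ((slots fs).length) [] (fun i => S + i) (S + (slots fs).length) m tpos

/-- **The oracle on scattered registers**: copy in, compute–XOR–uncompute, copy out.
[cite: NielsenChuang2010, §3.2.5 eq. (3.7)] -/
def ops : List (ClOp (Fin N)) := copyFin hN S fs ++ (inner hN e M S fs m tpos ++ copyFin hN S fs)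

/-- The top of the block: area, then the work window of the machine on `areaLen` data bits. [folklore] -/
abbrev top : ℕ := CleanPlaced.top e M ((slots fs).length) [] (S + (slots fs).length)

end Ops

variable {hN : 0 < N} {e : ℕ} {M : TM2ComputableAux Bool Bool} {S : ℕ} {fs : List (List ℕ)} {m : ℕ} {tpos : ℕ → ℕ}

/-- **Geometry hypotheses**: the block `[S, top)` fits below `N`; the sources are below `N`, off the
block; the targets are below `N`, pairwise distinct, off the block and off the sources; at most `JJ`
output bits are read. [folklore] -/
structure GeomOK (N e : ℕ) (M : TM2ComputableAux Bool Bool) (S : ℕ) (fs : List (List ℕ)) (m : ℕ) (tpos : ℕ → ℕ) :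
    Prop where
  top_le : top e M S fs ≤ N
  srcN : ∀ f ∈ fs, ∀ s ∈ f, s < N
  srcOff : SrcOff S (top e M S fs - S) fs
  tlt : ∀ j, j < m → tpos j < N
  tinj : ∀ j j', j < m → j' < m → tpos j = tpos j' → j = j'
  toff : ∀ j, j < m → tpos j < S ∨ top e M S fs ≤ tpos j
  tsrc : ∀ j, j < m → ∀ f ∈ fs, tpos j ∉ f
  mJJ : m ≤ JJ e M ((slots fs).length)

variable (G : GeomOK N e M S fs m tpos)
include G

omit G in
/-- The area lies inside the block. [folklore] -/
theorem areaLen_le_top : S + (slots fs).length ≤ top e M S fs := by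
  unfold top CleanPlaced.top; omega

/-- The geometry of the inner clean XOR block. [folklore] -/
theorem inner_geomOK : CleanXor.GeomOK N e M ((slots fs).length) [] (fun i => S + i) (S + (slots fs).length) m tpos where
  inj := fun i i' _ _ h => by omega
  lt := fun i hi => by omega
  top_le := G.top_le
  tinj := G.tinj
  tlt := G.tlt
  tdata := fun j i hj hi h => by rcases G.toff j hj with h' | h' <;> [omega; (have := areaLen_le_top (e := e) (M := M) (S := S) (fs := fs); omega)]
  twin := fun j hj => by rcases G.toff j hj with h | h <;> [exact Or.inl (by omega); exact Or.inr h]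
  mJJ := by simpa using G.mJJ

/-- Sources are off the area (weak form of `srcOff`). [folklore] -/
theorem srcOff_area : SrcOff S ((slots fs).length) fs := fun f hf s hs => by
  rcases G.srcOff f hf s hs with h | h
  · exact Or.inl h
  · right; have := areaLen_le_top (e := e) (M := M) (S := S) (fs := fs); omega

/-- The wires of the copy layer are below `N`. [folklore] -/
theorem copyL_lt : ∀ op ∈ copyL S fs, ∀ i ∈ wiresOf op, i < N :=
  wires_copyL_lt (by have := areaLen_le_top (e := e) (M := M) (S := S) (fs := fs); have := G.top_le; omega) G.srcN

/-- Semantics of the copy layer inside `Fin N`. [folklore] -/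
theorem clEval_copyFin (z : QReg N) (q : Fin N) :
    clEval (copyFin hN S fs) z q = clEval (copyL S fs) (liftW z) q :=
  clEval_map_finOf_apply hN _ (copyL_lt G) z q

/-- **The oracle is well formed.** [folklore] -/
theorem ops_wf : ∀ op ∈ ops hN e M S fs m tpos, op.WF := by
  intro op hop
  unfold ops at hop
  rw [List.mem_append, List.mem_append] at hop
  have hc : ∀ op ∈ copyFin hN S fs, op.WF := fun op hop => by
    unfold copyFin at hop
    obtain ⟨op', hop', rfl⟩ := List.mem_map.1 hop
    exact wf_map_finOf hN (copyL_lt G op' hop') (copyL_wf le_rfl (srcOff_area G) op' hop')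
  rcases hop with h | h | h
  · exact hc op h
  · exact CleanXor.ops_wf (inner_geomOK G) op h
  · exact hc op h

/-- The registers read off a label. [folklore] -/
abbrev regs (hN : 0 < N) (fs : List (List ℕ)) (z : QReg N) : List (List Bool) :=
  fs.map fun f => f.map fun s => z (finOf N hN s)

omit G in
/-- Reading the registers through `liftW`. [folklore] -/
theorem regs_eq_liftW (hsN : ∀ f ∈ fs, ∀ s ∈ f, s < N) (z : QReg N) :
    regs hN fs z = fs.map fun f => f.map (liftW z) := by
  refine List.map_congr_left fun f hf => List.map_congr_left fun s hs => ?_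
  rw [← liftW_comp_finOf hN z (hsN f hf s hs), Function.comp_apply]

/-- **Semantics of the oracle, target wires.** On a label whose block `[S, top)` is clean, with the
machine writing `l'` on the pair string `⟨r₁, ⟨r₂, … r_k⟩⟩` of the registers in time, target `j < m`
is XORed with `[l'[j]? = some true]`. [cite: NielsenChuang2010, §3.2.5 eq. (3.7)] -/
theorem clEval_ops_target (z : QReg N) (hclean : ∀ q, S ≤ q → q < top e M S fs → z (finOf N hN q) = false)
    (l' : List Bool) (hM : M.OutputsWithin (pairStr (regs hN fs z)) l' (Tn e (pairStr (regs hN fs z)).length))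
    {j : ℕ} (hj : j < m) :
    clEval (ops hN e M S fs m tpos) z (CleanXor.tgt hN tpos j) =
      (z (CleanXor.tgt hN tpos j) ^^ decide (l'[j]? = some true)) := by
  have hAT := areaLen_le_top (e := e) (M := M) (S := S) (fs := fs)
  have hT := G.top_le
  have hsa := srcOff_area G
  set z1 := clEval (copyFin hN S fs) z with hz1
  set z2 := clEval (inner hN e M S fs m tpos) z1 with hz2
  have htv : ((CleanXor.tgt hN tpos j : Fin N) : ℕ) = tpos j := CleanXor.val_tgt (inner_geomOK G) hj
  -- the data word on the area after the copy
  have hlen : (pairStr (regs hN fs z)).length = (slots fs).length := by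
    rw [regs_eq_liftW G.srcN, length_pairStr]
  have hzd : ∀ i, i < (slots fs).length → z1 (finOf N hN (S + i)) = (pairStr (regs hN fs z)).getD i false := by
    intro i hi
    rw [hz1, clEval_copyFin G, val_finOf_of_lt hN (by omega), regs_eq_liftW G.srcN,
      clEval_copyL_area_of_clean le_rfl hsa (liftW z) (fun a ha => ?_) hi]
    rw [← liftW_comp_finOf hN z (by omega), Function.comp_apply]
    exact hclean _ (by omega) (by omega)
  have hzw : ∀ w, S + (slots fs).length + w < top e M S fs → z1 (finOf N hN (S + (slots fs).length + w)) = false := by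
    intro w hw
    rw [hz1, clEval_copyFin G, val_finOf_of_lt hN (by omega), clEval_copyL_of_not _ (Or.inr (by omega)),
      ← liftW_comp_finOf hN z (by omega), Function.comp_apply]
    exact hclean _ (by omega) hw
  -- the inner block XORs the target
  have hM' : M.OutputsWithin (pairStr (regs hN fs z) ++ []) l' (Tn e ((pairStr (regs hN fs z)).length + ([] : List Bool).length)) := by
    simpa using hM
  have htgt : z2 (CleanXor.tgt hN tpos j) = (z1 (CleanXor.tgt hN tpos j) ^^ decide (l'[j]? = some true)) := by
    rw [hz2]
    exact CleanXor.clEval_ops_target (inner_geomOK G) _ l' hlen hM' z1 hzd hzw hj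
  -- the target is off the area: the copies do not touch it
  have htoff : tpos j < S ∨ S + (slots fs).length ≤ tpos j := by
    rcases G.toff j hj with h | h <;> [exact Or.inl h; exact Or.inr (by omega)]
  unfold ops
  rw [clEval_append, clEval_append, ← hz1, ← hz2, clEval_copyFin G, htv, clEval_copyL_of_not _ htoff, liftW,
    dif_pos (G.tlt j hj)]
  have hfin : (⟨tpos j, G.tlt j hj⟩ : Fin N) = CleanXor.tgt hN tpos j := Fin.ext (by rw [htv])
  rw [hfin, htgt, hz1, clEval_copyFin G, htv, clEval_copyL_of_not _ htoff, liftW, dif_pos (G.tlt j hj), hfin]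

/-- **Semantics of the oracle, all other wires**: unchanged, for every label (sources, area, window,
rest). [cite: NielsenChuang2010, §3.2.5 (uncomputation)] -/
theorem clEval_ops_of_ne (z : QReg N) (x : Fin N) (hx : ∀ j, j < m → x ≠ CleanXor.tgt hN tpos j) :
    clEval (ops hN e M S fs m tpos) z x = z x := by
  have hAT := areaLen_le_top (e := e) (M := M) (S := S) (fs := fs)
  have hT := G.top_le
  have hsa := srcOff_area G
  set z1 := clEval (copyFin hN S fs) z with hz1
  set z2 := clEval (inner hN e M S fs m tpos) z1 with hz2
  -- the inner block changes targets only
  have hin : ∀ q : Fin N, (∀ j, j < m → q ≠ CleanXor.tgt hN tpos j) → z2 q = z1 q := fun q hq => by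
    rw [hz2]; exact CleanXor.clEval_ops_of_ne (inner_geomOK G) z1 q hq
  have hnt : ∀ q : Fin N, ((q : ℕ) < S + (slots fs).length ∧ S ≤ (q : ℕ)) ∨ (∃ f ∈ fs, (q : ℕ) ∈ f) →
      ∀ j, j < m → q ≠ CleanXor.tgt hN tpos j := by
    rintro q hq j hj rfl
    rw [CleanXor.val_tgt (inner_geomOK G) hj] at hq
    rcases hq with ⟨h1, h2⟩ | ⟨f, hf, hmem⟩
    · rcases G.toff j hj with h | h <;> omega
    · exact G.tsrc j hj f hf hmem
  unfold ops
  rw [clEval_append, clEval_append, ← hz1, ← hz2, clEval_copyFin G]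
  -- `liftW z2` and `liftW z1` agree on the area and on the sources
  have hagree_area : ∀ a, a < (slots fs).length → liftW z2 (S + a) = liftW z1 (S + a) := by
    intro a ha
    simp only [liftW, show S + a < N by omega, dif_pos]
    exact hin _ (hnt _ (Or.inl ⟨by simp; omega, by simp⟩))
  have hagree_src : ∀ f ∈ fs, ∀ s ∈ f, liftW z2 s = liftW z1 s := by
    intro f hf s hs
    simp only [liftW, G.srcN f hf s hs, dif_pos]
    exact hin _ (hnt _ (Or.inr ⟨f, hf, by simpa using hs⟩))
  by_cases hxa : S ≤ (x : ℕ) ∧ (x : ℕ) < S + (slots fs).length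
  · -- on the area: the second copy undoes the first
    obtain ⟨a, ha, hxe⟩ : ∃ a, a < (slots fs).length ∧ (x : ℕ) = S + a := ⟨x - S, by omega, by omega⟩
    rw [hxe, clEval_copyL_congr_area le_rfl hsa hagree_area hagree_src ha]
    have hinv := congrFun (clEval_copyL_copyL le_rfl hsa (liftW z)) (S + a)
    have hz1' : liftW z1 = clEval (copyL S fs) (liftW z) := by
      funext i
      by_cases hi : i < N
      · rw [liftW, dif_pos hi, hz1, clEval_copyFin G]
      · rw [liftW, dif_neg hi]
        have hi' : i < S ∨ S + (slots fs).length ≤ i := Or.inr (by omega)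
        rw [clEval_copyL_of_not _ hi', liftW, dif_neg hi]
    rw [hz1', hinv, liftW, dif_pos (by omega)]
    congr 1; exact Fin.ext hxe.symm
  · have hx' : (x : ℕ) < S ∨ S + (slots fs).length ≤ (x : ℕ) := by omega
    rw [clEval_copyL_of_not _ hx', liftW_val, hin x hx, hz1, clEval_copyFin G, clEval_copyL_of_not _ hx', liftW_val]

/-! ### The circuit -/

/-- **The compiled oracle.** [cite: NielsenChuang2010, §3.2.5] -/
def circuit : QCircuit cliffordT N := ⟨revCompile (toRevList (ops hN e M S fs m tpos) (ops_wf G))⟩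

/-- The compiled oracle is oracle-free. [folklore] -/
theorem circuit_isOracleFree : (circuit G (hN := hN)).IsOracleFree := fun g hg => revCompile_isOracleFree _ g hg

/-- **The compiled oracle is the basis map of the oracle program.** [folklore] -/
theorem isBasisMap_circuit :
    IsBasisMap ((circuit G (hN := hN)).toMatrix 0) (clEval (ops hN e M S fs m tpos)) := fun z => by
  rw [circuit, revCompile_mulVec_basisState, revEval_toRevList]

/-- The compiled oracle is unitary. [folklore] -/
theorem circuit_mem_unitaryGroup : (circuit G (hN := hN)).toMatrix 0 ∈ Matrix.unitaryGroup (QReg N) ℂ :=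
  QCircuit.toMatrix_mem_unitaryGroup_holds cliffordT_isUnitary_holds 0 _

end PXor

end Literature.Computability.QuantumComplexity
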